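import Summits.ResolutionOfSingularities.ResolutionOfSingularities.Theorems.RadicialJungCleanModelsLens5KbarCossartGlobalToLocal
import Literature.AlgebraicGeometry.Resolution.AlterationsResolution
import Literature.AlgebraicGeometry.Resolution.PrincipalizationToResolution
import HarnessLib

/-!
# Route `RadicialJung`, crux `CleanModels` (stmt-15917) — (C-curve) sub-line, brick S0: a model regular at the centre containing a prescribed element,
# modulo Cossart–Piltant 2019 (F-02 `CossartPiltant2019`)

Lead `res-B-lead-1` g6 (plan `Cruxes/CleanModels/Lines/Sketch-memo-Ccurve-plan.md` §1 S0; head of `stub_Cc_rebaseD2`).  OURS · counted 0.  Nothing here proves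
resolution in characteristic `p`; resolution in char `p` is NOT proved; `CossartPiltant2019` is a PRINTED theorem typed as a hypothesis.

`exists_regular_model_mem_of_cossartPiltant2019`: for a finitely generated model `A ⊆ O` of `K/k` of dimension `≤ 3` all of whose centres are closed (`hzd`) and any
`t ∈ O`, there is a finitely generated model `B ⊇ A` inside `O`, containing `t`, whose local ring at the centre of `O` is regular of dimension `dim A`.  Proof: F-02 on
`Spec A[t]` (reduced, affine, finite type, dimension `≤ 3`) gives a resolution `π : X′ → Spec A[t]` (proper, birational, `X′` regular); extract the model at the centre of
`O` (✓ `exists_model_of_proper_birational`, valuative criterion) and re-base it over `k` — the pattern of ✓ `Lens5.KbarCossart.nuZeroAlongValuation_of_cossart1987Thm`.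
Used by S0 of the (C-curve) plan with `t ∈ 𝔪_O` a `v₁`-unit (so that the centre of the coarsening `O₁` on `B` is a curve), and reusable wherever «LU with a
prescribed element in the model» is wanted.
-/

noncomputable section

set_option linter.dupNamespace false

open IsLocalRing AlgebraicGeometry CategoryTheory
open Literature.AlgebraicGeometry.Resolution Literature.AlgebraicGeometry.Motives

namespace Summit.ResolutionOfSingularities.ResolutionOfSingularities.Theorems.RadicialJung.CleanModels.Ccurve

/-- **A model regular at the centre of `O` containing a prescribed element `t ∈ O`** (mod F-02 = `CossartPiltant2019`): for `A ⊆ O` finitely generated over `k`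
with `Frac A = K`, `dim A = d ≤ 3`, all centres above `A` closed, and `t ∈ O`, there is a finitely generated `B ⊇ A` inside `O` with `t ∈ B` and `locAtCentre B O`
regular of dimension `d`. [folklore] -/
theorem exists_regular_model_mem_of_cossartPiltant2019 (hCP : CossartPiltant2019.{0})
    (k : Type) [Field k] (K : Type) [Field K] [Algebra k K]
    (O : ValuationSubring K) (A : Subalgebra k K) (hAO : A.toSubring ≤ O.toSubring) (hAfg : A.FG)
    (hfr : IsFractionRing A K) {d : ℕ} (hdimA : ringKrullDim A = d) (hd3 : d ≤ 3)
    (hzd : ∀ (T : Subring K) (hT : T ≤ O.toSubring), A.toSubring ≤ T → (subringCentre T O hT).IsMaximal)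
    (t : K) (ht : t ∈ O) :
    ∃ (B : Subalgebra k K), B.toSubring ≤ O.toSubring ∧ A ≤ B ∧ B.FG ∧ t ∈ B ∧
      IsRegularLocalRing (locAtCentre B.toSubring O) ∧ ringKrullDim (locAtCentre B.toSubring O) = d := by
  classical
  haveI := hfr
  -- Step 1: `A₁ = A[t]`
  obtain ⟨s₀, rfl⟩ := hAfg
  set A₁ : Subalgebra k K := Algebra.adjoin k (insert t (s₀ : Set K)) with hA₁def
  have hAA₁ : Algebra.adjoin k (s₀ : Set K) ≤ A₁ := Algebra.adjoin_mono (Set.subset_insert _ _)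
  have htA₁ : t ∈ A₁ := Algebra.subset_adjoin (Set.mem_insert _ _)
  have hA₁O : A₁.toSubring ≤ O.toSubring := by
    have h1 : A₁ ≤ { carrier := (O : Set K)
                     mul_mem' := fun ha hb => O.toSubring.mul_mem ha hb
                     one_mem' := O.toSubring.one_mem
                     add_mem' := fun ha hb => O.toSubring.add_mem ha hb
                     zero_mem' := O.toSubring.zero_mem
                     algebraMap_mem' := fun c => hAO ((Algebra.adjoin k (s₀ : Set K)).algebraMap_mem c) } := by
      refine Algebra.adjoin_le ?_
      rintro z (rfl | hz)
      · exact ht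
      · exact hAO (Algebra.subset_adjoin hz)
    exact fun z hz => h1 hz
  have hA₁fg : A₁.FG := ⟨insert t s₀, by rw [hA₁def]; push_cast; rfl⟩
  haveI hfr₁ : IsFractionRing A₁ K := isFractionRing_of_le hAA₁ hfr
  haveI : Algebra.FiniteType k A₁ := A₁.fg_iff_finiteType.mp hA₁fg
  haveI : IsNoetherianRing A₁ := Algebra.FiniteType.isNoetherianRing k A₁
  -- transcendence degree and dimensions
  have htrdeg : Algebra.trdeg k K = d := by
    rw [trdeg_eq_trdeg_of_isFractionRing (Algebra.adjoin k (s₀ : Set K))]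
    haveI : Algebra.FiniteType k (Algebra.adjoin k (s₀ : Set K)) :=
      (Algebra.adjoin k (s₀ : Set K)).fg_iff_finiteType.mp ⟨s₀, rfl⟩
    obtain ⟨n, hn, htr⟩ := exists_ringKrullDim_eq_and_trdeg_eq k (Algebra.adjoin k (s₀ : Set K))
    rw [hdimA] at hn
    have hnd : n = d := by exact_mod_cast hn.symm
    rw [htr, hnd]
  have hA₁dim : ringKrullDim A₁ ≤ 3 := ringKrullDim_le_of_fg_of_trdeg_le A₁ hA₁fg (by rw [htrdeg]; exact_mod_cast hd3)
  -- Step 2: the scheme `X = Spec A₁` over `k`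
  let R : CommRingCat.{0} := CommRingCat.of A₁
  haveI : IsDomain R := inferInstanceAs (IsDomain A₁)
  letI : Algebra R K := inferInstanceAs (Algebra A₁ K)
  haveI : IsFractionRing R K := inferInstanceAs (IsFractionRing A₁ K)
  let X : Scheme.{0} := Spec R
  let sX : X ⟶ Spec (.of k) := Spec.map (CommRingCat.ofHom (algebraMap k A₁))
  haveI : LocallyOfFiniteType sX := Lens5.KbarCossart.locallyOfFiniteType_Spec k A₁
  haveI : IsSeparated sX := inferInstanceAs (IsSeparated (Spec.map (CommRingCat.ofHom (algebraMap k A₁))))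
  haveI : QuasiCompact sX := inferInstance
  haveI : IsReduced X := inferInstance
  have hXdim : topologicalKrullDim X ≤ 3 :=
    (PrimeSpectrum.topologicalKrullDim_eq_ringKrullDim (R := A₁) : topologicalKrullDim X = ringKrullDim A₁).trans_le hA₁dim
  -- Step 3: Cossart–Piltant 2019
  obtain ⟨X', π, hres⟩ := hCP k X sX inferInstance inferInstance inferInstance inferInstance hXdim
  haveI := hres.isProper
  haveI : IsDominant π := hres.isBirational.isDominant
  haveI : IsReduced X' := hres.isRegular.isReduced
  haveI : IsIntegral X' := hres.isBirational.isIntegral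
  -- Step 4: extraction at the centre of `O`
  obtain ⟨x, T, hTO, hTfg, δ, Θ, -, -⟩ :=
    exists_model_of_proper_birational (A := A₁) (K := K) O (fun b => hA₁O b.2) π hres.isProper hres.isBirational
  haveI hregT : IsRegularLocalRing (locAtCentre T.toSubring O) := by
    haveI := hres.isRegular x
    exact IsRegularLocalRing.of_ringEquiv δ
  -- Step 5: re-base `T` over `k`
  obtain ⟨tT, htT⟩ := hTfg
  have e : (Algebra.adjoin k (insert t (s₀ : Set K) ∪ (tT : Set K))).toSubring = T.toSubring := by
    rw [Algebra.adjoin_union_eq_adjoin_adjoin, ← htT]; rfl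
  set B : Subalgebra k K := Algebra.adjoin k (insert t (s₀ : Set K) ∪ (tT : Set K)) with hBdef
  have hBO : B.toSubring ≤ O.toSubring := by rw [e]; exact hTO
  have hA₁B : A₁ ≤ B := Algebra.adjoin_mono Set.subset_union_left
  have hBfg : B.FG := ⟨insert t s₀ ∪ tT, by rw [hBdef]; push_cast; rfl⟩
  have hregB : IsRegularLocalRing (locAtCentre B.toSubring O) := by rw [e]; exact hregT
  refine ⟨B, hBO, hAA₁.trans hA₁B, hBfg, hA₁B htA₁, hregB, ?_⟩
  -- dimension at the (maximal) centre = `dim B = d`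
  haveI : IsFractionRing B K := isFractionRing_of_le (hAA₁.trans hA₁B) hfr
  rw [ringKrullDim_locAtCentre_eq_of_isMaximal B hBfg O hBO (hzd _ hBO (fun z hz => (hAA₁.trans hA₁B) hz))]
  haveI : Algebra.FiniteType k B := B.fg_iff_finiteType.mp hBfg
  obtain ⟨n, hn, htr⟩ := exists_ringKrullDim_eq_and_trdeg_eq k B
  rw [← trdeg_eq_trdeg_of_isFractionRing B, htrdeg] at htr
  have hnd : n = d := by exact_mod_cast htr.symm
  rw [hn, hnd]

end Summit.ResolutionOfSingularities.ResolutionOfSingularities.Theorems.RadicialJung.CleanModels.Ccurve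

end
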